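import Summits.FinalStateConjecture.FinalStateConjecture.Theorems.DerivativeThriftThriftyHandoffDefs
import Literature.Geometry.Lorentzian.RecedingKerrLayerLabTimeChart
import HarnessLib

/-!
# `ThriftyHandoff` (stmt-FinalStateConjecture-17612): the lab time of the thrifty hand-over is IDLE

Slack audit of clause (iii) of the crux `DerivativeThrift.ThriftyHandoff` (= the antecedent of
`DerivativeThrift.ThriftyClusterSettling`; `FullHandoff`, and the weak form `WeakHandoff` concluded
by the line's stub `stub_censoredCapture`): the clause asks "for every `ℓ, ε` AND EVERY LAB TIME
`τ₁`, a lab time `τ ≥ τ₁`" at which an `ε`-thrifty layer chart exists. But the lab time enters only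
through a time translation of `E4` which the chart absorbs
(`RecedingKerr.exists_layerChart_at_of_exists`, `Literature/…/RecedingKerrLayerLabTimeChart.lean`:
a chart of `RecedingKerr.layer M a Λ ξ τ ℓ` re-times to a chart of `RecedingKerr.layer M a Λ ξ τ' ℓ`
for every `τ'`, with the same image, the same leaf images and the same layer norm). Hence both
hand-over clauses are EQUIVALENT to their UNTIMED forms "for every `ℓ, ε` there are SOME lab time
`τ`, centres and a chart …" (`fullHandoff_iff_untimed`, `weakHandoff_iff_untimed`): "arbitrarily
late" carries no intrinsic content — lateness of the hand-over is expressed, if at all, only by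
`range Φ ⊆ J⁺(ιX)` and by where the consumer (`ThriftyKerrStability`: conclusions inside
`J⁺(range Φ)`) looks. This is a remark for the planners (the clause is weaker than its wording
suggests, not trivial: the layer still has to be embedded `ε`-close to the multi-Kerr reference on
COMPLETE hyperboloidal leaves); it neither proves nor refutes any stub. Pure logic over the cited
covariance theorem; no definitions, no named facts.
-/

noncomputable section

-- D-0017: single-problem summit, `Summit.<S>.<S>.…` by design.
set_option linter.dupNamespace false

open Set Function Filter TopologicalSpace
open scoped Manifold ContDiff Topology ENNReal

namespace Summit.FinalStateConjecture.FinalStateConjecture.Theorems.DerivativeThriftThriftyHandoff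

open Literature.Geometry.Lorentzian

variable {X : Type} [TopologicalSpace X] [ChartedSpace E3 X] [IsManifold (𝓡 3) ∞ X]
  [ConnectedSpace X] {D : InitialDataSet (𝓡 3) X} (𝒟 : VacuumCauchyDevelopment D)

/-- **The full thrifty hand-over is equivalent to its untimed form** (drop "`∀ τ₁, ∃ τ ≥ τ₁`" in
favour of "`∃ τ`"): `→` by `τ₁ := 0`; `←` by re-timing the given chart to the lab time `τ₁`
(`RecedingKerr.exists_layerChart_at_of_exists` with `J := J⁺(ιX)` and `A :=` achronality), which
preserves smoothness, the open-embedding property, the image, the leaf images and the layer norm.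
Klainerman–Szeftel arXiv:2104.11857, §3.1 (the initial data layer is placed by the solution, not
by a lab clock). [folklore] -/
theorem fullHandoff_iff_untimed :
    FullHandoff 𝒟 ↔ ∃ (N : ℕ) (M a : Fin N → ℝ) (Λ : Fin N → ↥lorentzGroup), (∀ i, Kerr.IsSubextremal (M i) (a i)) ∧ (∀ i, Summit.FinalStateConjecture.IsOrthochronous (Λ i)) ∧ (∀ i j, i ≠ j → (((Λ i : E4 ≃L[ℝ] E4) (E4.basisVector 0)) 0)⁻¹ • E4.spatial ((Λ i : E4 ≃L[ℝ] E4) (E4.basisVector 0)) ≠ (((Λ j : E4 ≃L[ℝ] E4) (E4.basisVector 0)) 0)⁻¹ • E4.spatial ((Λ j : E4 ≃L[ℝ] E4) (E4.basisVector 0))) ∧ ∀ ℓ : ℝ, 0 < ℓ → ∀ ε : ℝ, 0 < ε → ∃ (τ : ℝ) (ξ : Fin N → E3) (Φ : RecedingKerr.layer M a Λ ξ τ ℓ → 𝒟.carrier), (∀ i j, i ≠ j → ε⁻¹ ≤ ‖ξ i - ξ j‖ ∧ 0 ≤ @inner ℝ E3 _ (ξ i - ξ j) ( (((Λ i : E4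 ≃L[ℝ] E4) (E4.basisVector 0)) 0)⁻¹ • E4.spatial ((Λ i : E4 ≃L[ℝ] E4) (E4.basisVector 0)) - (((Λ j : E4 ≃L[ℝ] E4) (E4.basisVector 0)) 0)⁻¹ • E4.spatial ((Λ j : E4 ≃L[ℝ] E4) (E4.basisVector 0)))) ∧ ContMDiff 𝓘(ℝ, E4) (𝓡 4) ((⊤ : ℕ∞) : WithTop ℕ∞) Φ ∧ Topology.IsOpenEmbedding Φ ∧ Set.range Φ ⊆ 𝒟.metric.causalFuture 𝒟.timeOrientation (Set.range 𝒟.embed) ∧ (∀ s₀ ∈ Set.Ioo 0 ℓ, 𝒟.metric.IsAchronal 𝒟.timeOrientation (Φ '' {x | RecedingKerr.layerTime τ ℓ x.1 = s₀})) ∧ 𝒟.toSpacetime.recedingKerrInitialLayerNorm M a Λ ξ τ ℓ 2 (1 / 2) (1 / 2) Φ ≤ ENNReal.ofReal ε := by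
  constructor
  · rintro ⟨N, M, a, Λ, hsub, horth, hvel, h⟩
    refine ⟨N, M, a, Λ, hsub, horth, hvel, fun ℓ hℓ ε hε ↦ ?_⟩
    obtain ⟨τ, -, ξ, Φ, hΦ⟩ := h ℓ hℓ ε hε 0
    exact ⟨τ, ξ, Φ, hΦ⟩
  · rintro ⟨N, M, a, Λ, hsub, horth, hvel, h⟩
    refine ⟨N, M, a, Λ, hsub, horth, hvel, fun ℓ hℓ ε hε τ₁ ↦ ⟨τ₁, le_rfl, ?_⟩⟩
    obtain ⟨τ, ξ, Φ, hsep, hs, ho, hr, ha, hn⟩ := h ℓ hℓ ε hε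
    obtain ⟨Ψ, hs', ho', hr', ha', hn'⟩ :=
      RecedingKerr.exists_layerChart_at_of_exists M a Λ ξ τ ℓ
        (J := 𝒟.metric.causalFuture 𝒟.timeOrientation (Set.range 𝒟.embed))
        (A := fun S ↦ 𝒟.metric.IsAchronal 𝒟.timeOrientation S) τ₁ ⟨Φ, hs, ho, hr, ha, hn⟩
    exact ⟨ξ, Ψ, hsep, hs', ho', hr', ha', hn'⟩

/-- **The weak thrifty hand-over is equivalent to its untimed form** (same proof). [folklore] -/
theorem weakHandoff_iff_untimed :
    WeakHandoff 𝒟 ↔ ∃ (N : ℕ) (M a : Fin N → ℝ) (Λ : Fin N → ↥lorentzGroup), (∀ i, Kerr.IsSubextremal (M i) (a i) ∨ Kerr.IsExtremal (M i) (a i)) ∧ (∀ i, Summit.FinalStateConjecture.IsOrthochronous (Λ i)) ∧ ∀ ℓ : ℝ, 0 < ℓ → ∀ ε : ℝ, 0 < ε → ∃ (τ : ℝ) (ξ : Fin N → E3) (Φ : RecedingKerr.layer M a Λ ξ τ ℓ → 𝒟.carrier), (∀ i j, i ≠ j → ε⁻¹ ≤ ‖ξ i - ξ j‖ ∧ 0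 ≤ @inner ℝ E3 _ (ξ i - ξ j) ( (((Λ i : E4 ≃L[ℝ] E4) (E4.basisVector 0)) 0)⁻¹ • E4.spatial ((Λ i : E4 ≃L[ℝ] E4) (E4.basisVector 0)) - (((Λ j : E4 ≃L[ℝ] E4) (E4.basisVector 0)) 0)⁻¹ • E4.spatial ((Λ j : E4 ≃L[ℝ] E4) (E4.basisVector 0)))) ∧ ContMDiff 𝓘(ℝ, E4) (𝓡 4) ((⊤ : ℕ∞) : WithTop ℕ∞) Φ ∧ Topology.IsOpenEmbedding Φ ∧ Set.range Φ ⊆ 𝒟.metric.causalFuture 𝒟.timeOrientation (Set.range 𝒟.embed) ∧ (∀ s₀ ∈ Set.Ioo 0 ℓ, 𝒟.metric.IsAchronal 𝒟.timeOrientation (Φ '' {x | RecedingKerr.layerTime τ ℓ x.1 = s₀})) ∧ 𝒟.toSpacetime.recedingKerrInitialLayerNorm M a Λ ξ τ ℓ 2 (1 / 2) (1 / 2) Φ ≤ ENNReal.ofReal ε := by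
  constructor
  · rintro ⟨N, M, a, Λ, hlab, horth, h⟩
    refine ⟨N, M, a, Λ, hlab, horth, fun ℓ hℓ ε hε ↦ ?_⟩
    obtain ⟨τ, -, ξ, Φ, hΦ⟩ := h ℓ hℓ ε hε 0
    exact ⟨τ, ξ, Φ, hΦ⟩
  · rintro ⟨N, M, a, Λ, hlab, horth, h⟩
    refine ⟨N, M, a, Λ, hlab, horth, fun ℓ hℓ ε hε τ₁ ↦ ⟨τ₁, le_rfl, ?_⟩⟩
    obtain ⟨τ, ξ, Φ, hsep, hs, ho, hr, ha, hn⟩ := h ℓ hℓ ε hε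
    obtain ⟨Ψ, hs', ho', hr', ha', hn'⟩ :=
      RecedingKerr.exists_layerChart_at_of_exists M a Λ ξ τ ℓ
        (J := 𝒟.metric.causalFuture 𝒟.timeOrientation (Set.range 𝒟.embed))
        (A := fun S ↦ 𝒟.metric.IsAchronal 𝒟.timeOrientation S) τ₁ ⟨Φ, hs, ho, hr, ha, hn⟩
    exact ⟨ξ, Ψ, hsep, hs', ho', hr', ha', hn'⟩

end Summit.FinalStateConjecture.FinalStateConjecture.Theorems.DerivativeThriftThriftyHandoff

end
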